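import Literature.AlgebraicGeometry.Motives.HodgeLieWeightOneGradingTwoRoots
import HarnessLib

/-!
# Weight-one Hodge structures with `dim 𝔤⁺ = dim 𝔤⁰ = 2` and `𝔷 = 0`, II: `E Ē E ≠ 0`, the identities of
# `π = α⁻¹(EF + FE)`, and the real constants `EᵢFᵢEᵢ = αᵢEᵢ`, `FᵢEᵢFᵢ = αᵢFᵢ` of the root vectors

Family `hodge`, layer `Literature/AlgebraicGeometry/Motives`; THEOREMS ONLY (no definition, no named fact; D-0026).
Fifth abstract file (constants) of the lane MT-RANK-SEVEN-SIMPLE of the cell `pub-hodgecm2` (COR-CM), seat `b27` gen 40; sequel of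
`Motives/HodgeLieWeightOneGradingTwoRoots` (root vectors `E₁, E₂ ∈ 𝔤⁺`, `Fᵢ = Ēᵢ ∈ 𝔤⁻`, `E₁F₂ = F₂E₁ = E₂F₁ =
F₁E₂ = 0`).  Setting as there (`H` of weight `1`, polarization `ψ`, graded basis `e`, `P = gradingEnd e deg`,
`𝔤 = 𝔥_ℂ`, `𝔷 = 0`, `dim 𝔤⁺ = dim 𝔤⁰ = 2`).

* §1 `mul_conjOp_mul_ne_zero_of_plus` — **`E Ē E ≠ 0`** for `0 ≠ E ∈ 𝔤⁺` (second Hodge–Riemann relation at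
  `u = Ē E w ∈ V^{0,1}`); `projector_identities` — for `E F E = αE`, `F E F = αF`, `α ≠ 0`: `π = α⁻¹(EF + FE)` is an
  idempotent commuting with `P`, `Eπ = E = πE`, `Fπ = F = πF`, `Pπ = α⁻¹EF`, `(2P−1)π = α⁻¹[E,F]` (the complex twin of
  `idealProjector_identities`).
* §2 `exists_smul_of_rootVectors` — **`E₁F₁E₁ = α₁E₁`, `F₁E₁F₁ = α₁F₁` with `α₁ ≠ 0` REAL**: `E₁F₁E₁ = ½[[E₁,F₁],E₁]`
  lies in `𝔤⁺ = ℂE₁ ⊕ ℂE₂` and is killed by `F₂` on the right (`E₁F₂ = 0`), so its `E₂`-component vanishes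
  (`E₂F₂ ≠ 0`); conjugation gives `ᾱ₁F₁ = F₁E₁F₁ = α₁F₁`.

The sequel `Motives/HodgeLieWeightOneGradingTwoProjectors` assembles the two complementary real idempotents
`πᵢ = αᵢ⁻¹(EᵢFᵢ + FᵢEᵢ)` (`π₁ + π₂ = 1`, `π₁π₂ = 0`, commuting with `𝔤`).

## References

* [MoonenZarhin1999LowDim] B. Moonen, Yu. Zarhin, *Hodge classes on abelian varieties of low dimension*, Math. Ann. 315
  (1999), §2 and (2.3).
* [Deligne1982HodgeCycles] P. Deligne, *Hodge cycles on abelian varieties*, LNM 900 (1982), I §3 (proof of Prop. 3.4,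
  3.6).
* [FultonHarris1991] W. Fulton, J. Harris, *Representation Theory*, GTM 129 (1991), Lecture 11 (§11.1).
* [Zarhin1983HodgeGroupsK3] Yu. Zarhin, *Hodge groups of K3 surfaces*, J. reine angew. Math. 341 (1983), §2.
-/

noncomputable section

open scoped TensorProduct

namespace Literature.AlgebraicGeometry.Motives

universe u

namespace HodgeStructure

open ProjectorBlocks Literature.RepresentationTheory.GeneralLinear

variable {V : Type u} [AddCommGroup V] [Module ℚ V] [Module.Finite ℚ V] [HodgeTensorFacts.{u, u}] {n : ℤ}
  {S : Type u} [Fintype S] [DecidableEq S] {deg : S → ℤ}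

/-! ## §1 `E Ē E ≠ 0`, and the identities of `π = α⁻¹(EF + FE)` -/

/-- **`E Ē E ≠ 0` for a non-zero `E ∈ 𝔤⁺`** with conjugate `Ē` (weight `1`, `ψ` a polarization): for `w` with
`u = Ē E w ≠ 0` (`Ē E ≠ 0`, `mul_conjOp_ne_zero_of_plus`), `u ∈ V^{0,1}`, `ū = E Ē w̄` and
`ψ_ℂ(u, ū) = −ψ_ℂ(E Ē E w, Ē w̄)`, against the second Hodge–Riemann relation. [cite: MoonenZarhin1999LowDim, §2]
[cite: Deligne1982HodgeCycles, I §3 (proof of Prop. 3.4)] -/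
theorem mul_conjOp_mul_ne_zero_of_plus (H : HodgeStructure V n) (ψ : H.Polarization) (hn : n = 1)
    (e : Module.Basis S ℂ (ℂ ⊗[ℚ] V)) (hF : ∀ a, H.F a = Submodule.span ℂ (e '' {σ | a ≤ deg σ}))
    (hFc : ∀ a, complexConj (H.F a) = Submodule.span ℂ (e '' {σ | deg σ ≤ n - a}))
    (hdeg : ∀ σ, deg σ = 0 ∨ deg σ = 1) {E Eb : Module.End ℂ (ℂ ⊗[ℚ] V)} (hEg : E ∈ H.hodgeLieC)
    (hE : gradingEnd e deg * E * (1 - gradingEnd e deg) = E) (hE0 : E ≠ 0)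
    (hEb : ∀ v, Eb v = conj (E (conj v))) : E * Eb * E ≠ 0 := by
  classical
  obtain ⟨-, hEbE⟩ := mul_conjOp_ne_zero_of_plus H ψ hn e hF hFc hdeg hEg hE hE0 hEb
  subst hn
  have hPP := gradingEnd_mul_gradingEnd_of_deg e hdeg
  have hEbm := (conjOp_grading H rfl e hF hFc hEb).1 hE
  obtain ⟨-, -, -, -, -, hQF⟩ := corner_identities (K := ℂ) hPP hE hEbm
  intro h0
  obtain ⟨w, hw⟩ : ∃ w, (Eb * E) w ≠ 0 := by
    by_contra h
    push Not at h
    exact hEbE (LinearMap.ext fun w => by rw [h w, LinearMap.zero_apply])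
  have hmem : (Eb * E) w ∈ H.piece 0 ((1 : ℤ) - 0) := by
    rw [piece_eq_span_of_graded H e hF hFc 0, ← hQF, Module.End.mul_apply, Module.End.mul_apply]
    exact one_sub_gradingEnd_apply_mem_span_zero e hdeg _
  obtain ⟨r, hr, hre⟩ := ψ.pos 0 ((1 : ℤ) - 0) (by ring) ((Eb * E) w) hmem hw
  -- `conj (Ē E w) = E Ē (conj w)`
  have hEbb : ∀ v, E v = conj (Eb (conj v)) := fun v => by rw [hEb, conj_conj, conj_conj]
  have hconj : conj ((Eb * E) w) = (E * Eb) (conj w) := by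
    have h := conjOp_mul_apply hEbb hEb (conj w)
    rw [conj_conj] at h
    exact h
  have hzero : ψ.form.baseChange ℂ ((Eb * E) w) (conj ((Eb * E) w)) = 0 := by
    have hsk := formBaseChange_skew_of_mem_hodgeLieC ψ hEg (Eb (E w)) (Eb (conj w))
    have h3 : E (Eb (E w)) = (E * Eb * E) w := rfl
    rw [h3, h0, LinearMap.zero_apply, map_zero, LinearMap.zero_apply, zero_eq_neg] at hsk
    rw [hconj, Module.End.mul_apply, Module.End.mul_apply]
    exact hsk
  rw [hzero, mul_zero] at hre
  have hr0 : (r : ℂ) = 0 := hre.symm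
  exact hr.ne' (by exact_mod_cast hr0)

omit [Module.Finite ℚ V] [HodgeTensorFacts.{u, u}] in
/-- **Identities of `π = α⁻¹(EF + FE)`** for `E ∈ Eig₁`, `F ∈ Eig₋₁` with `E F E = αE`, `F E F = αF`, `α ≠ 0` (degrees
in `{0,1}`): `π² = π`, `Pπ = α⁻¹EF = πP`, `Eπ = E = πE`, `Fπ = F = πF`, `(2P − 1)π = α⁻¹(EF − FE)` — the complex twin
of `idealProjector_identities`. [cite: FultonHarris1991, Lecture 11 (§11.1)] [cite: MoonenZarhin1999LowDim, §2] -/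
theorem rootProjector_identities (e : Module.Basis S ℂ (ℂ ⊗[ℚ] V)) (hdeg : ∀ σ, deg σ = 0 ∨ deg σ = 1)
    {E F : Module.End ℂ (ℂ ⊗[ℚ] V)} (hE : gradingEnd e deg * E * (1 - gradingEnd e deg) = E)
    (hFm : (1 - gradingEnd e deg) * F * gradingEnd e deg = F) {α : ℂ} (hα : α ≠ 0) (hEFE : E * F * E = α • E)
    (hFEF : F * E * F = α • F) :
    (α⁻¹ • (E * F + F * E)) * (α⁻¹ • (E * F + F * E)) = α⁻¹ • (E * F + F * E) ∧
      gradingEnd e deg * (α⁻¹ • (E * F + F * E)) = α⁻¹ • (E * F) ∧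
      (α⁻¹ • (E * F + F * E)) * gradingEnd e deg = α⁻¹ • (E * F) ∧
      E * (α⁻¹ • (E * F + F * E)) = E ∧ (α⁻¹ • (E * F + F * E)) * E = E ∧
      F * (α⁻¹ • (E * F + F * E)) = F ∧ (α⁻¹ • (E * F + F * E)) * F = F ∧
      ((2 : ℂ) • gradingEnd e deg - 1) * (α⁻¹ • (E * F + F * E)) = α⁻¹ • (E * F - F * E) := by
  have hPP := gradingEnd_mul_gradingEnd_of_deg e hdeg
  set P := gradingEnd e deg with hP
  obtain ⟨hPE, hEP, -, hPF, hFP, -⟩ := corner_identities (K := ℂ) hPP hE hFm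
  have hEE : E * E = 0 := mul_eq_zero_of_plus_plus (K := ℂ) hPP hE hE
  have hFF : F * F = 0 := mul_eq_zero_of_minus_minus (K := ℂ) hPP hFm hFm
  have h1 : E * F * (E * F) = α • (E * F) := by rw [← mul_assoc (E * F) E F, hEFE, smul_mul_assoc]
  have h2 : E * F * (F * E) = 0 := by rw [← mul_assoc (E * F) F E, mul_assoc E F F, hFF, mul_zero, zero_mul]
  have h3 : F * E * (E * F) = 0 := by rw [← mul_assoc (F * E) E F, mul_assoc F E E, hEE, mul_zero, zero_mul]
  have h4 : F * E * (F * E) = α • (F * E) := by rw [← mul_assoc (F * E) F E, hFEF, smul_mul_assoc]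
  refine ⟨?_, ?_, ?_, ?_, ?_, ?_, ?_, ?_⟩
  · calc (α⁻¹ • (E * F + F * E)) * (α⁻¹ • (E * F + F * E))
        = (α⁻¹ * α⁻¹) • ((E * F + F * E) * (E * F + F * E)) := by rw [smul_mul_smul_comm]
      _ = (α⁻¹ * α⁻¹) • (α • (E * F) + α • (F * E)) := by
          simp only [mul_add, add_mul, h1, h2, h3, h4, add_zero, zero_add]
      _ = α⁻¹ • (E * F + F * E) := by rw [← smul_add, smul_smul, mul_assoc, inv_mul_cancel₀ hα, mul_one]
  · rw [mul_smul_comm, mul_add, ← mul_assoc P E F, hPE, ← mul_assoc P F E, hPF, zero_mul, add_zero]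
  · rw [smul_mul_assoc, add_mul, mul_assoc E F P, hFP, mul_assoc F E P, hEP, mul_zero, add_zero]
  · rw [mul_smul_comm, mul_add, ← mul_assoc E E F, hEE, zero_mul, zero_add, ← mul_assoc E F E, hEFE, smul_smul,
      inv_mul_cancel₀ hα, one_smul]
  · rw [smul_mul_assoc, add_mul, hEFE, mul_assoc F E E, hEE, mul_zero, add_zero, smul_smul, inv_mul_cancel₀ hα,
      one_smul]
  · rw [mul_smul_comm, mul_add, ← mul_assoc F E F, hFEF, ← mul_assoc F F E, hFF, zero_mul, add_zero, smul_smul,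
      inv_mul_cancel₀ hα, one_smul]
  · rw [smul_mul_assoc, add_mul, mul_assoc E F F, hFF, mul_zero, zero_add, hFEF, smul_smul, inv_mul_cancel₀ hα,
      one_smul]
  · rw [sub_mul, one_mul, smul_mul_assoc, mul_smul_comm, mul_add, ← mul_assoc P E F, hPE, ← mul_assoc P F E, hPF,
      zero_mul, add_zero]
    module

/-! ## §2 The constants `EᵢFᵢEᵢ = αᵢEᵢ`, `FᵢEᵢFᵢ = αᵢFᵢ` -/

/-- **`E₁F₁E₁ = α₁E₁` and `F₁E₁F₁ = α₁F₁` with `α₁ ≠ 0` real**, for root vectors `E₁, E₂` spanning `𝔤⁺` with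
conjugates `F₁, F₂` and `E₁F₂ = 0 = E₂F₁ = F₁E₂` (weight `1`, `ψ` a polarization).  PROOF: `T = E₁F₁E₁ = ½[[E₁,F₁],E₁]`
lies in `𝔤⁺`, so `T = xE₁ + yE₂`; right-multiplying by `F₂` kills `T` (`E₁F₂ = 0`) and `E₁`, leaving `yE₂F₂ = 0`,
so `y = 0` (`E₂F₂ ≠ 0`); likewise `F₁E₁F₁ = x'F₁` (kill with `E₂`); `x = x'` from `F₁(E₁F₁E₁) = (F₁E₁F₁)E₁`, `x ≠ 0` from
`E₁F₁E₁ ≠ 0`, and `x̄ = x` by conjugating `E₁F₁E₁ = xE₁`. [cite: MoonenZarhin1999LowDim, §2 and (2.3)]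
[cite: FultonHarris1991, Lecture 11 (§11.1)] -/
theorem exists_smul_of_rootVectors (H : HodgeStructure V n) (ψ : H.Polarization) (hn : n = 1)
    (e : Module.Basis S ℂ (ℂ ⊗[ℚ] V)) (hF : ∀ a, H.F a = Submodule.span ℂ (e '' {σ | a ≤ deg σ}))
    (hFc : ∀ a, complexConj (H.F a) = Submodule.span ℂ (e '' {σ | deg σ ≤ n - a}))
    (hdeg : ∀ σ, deg σ = 0 ∨ deg σ = 1) {E₁ E₂ F₁ F₂ : Module.End ℂ (ℂ ⊗[ℚ] V)}
    (hE₁g : E₁ ∈ H.hodgeLieC) (hE₂g : E₂ ∈ H.hodgeLieC) (hF₁g : F₁ ∈ H.hodgeLieC)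
    (hE₁ : gradingEnd e deg * E₁ * (1 - gradingEnd e deg) = E₁)
    (hE₂ : gradingEnd e deg * E₂ * (1 - gradingEnd e deg) = E₂)
    (hF₁ : ∀ v, F₁ v = conj (E₁ (conj v))) (hF₂ : ∀ v, F₂ v = conj (E₂ (conj v)))
    (hind : ∀ x y : ℂ, x • E₁ + y • E₂ = 0 → x = 0 ∧ y = 0)
    (hspan : ∀ E ∈ H.hodgeLieC, gradingEnd e deg * E * (1 - gradingEnd e deg) = E → ∃ x y : ℂ, E = x • E₁ + y • E₂)
    (k12 : E₁ * F₂ = 0) (k21' : F₁ * E₂ = 0) :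
    ∃ α : ℂ, α ≠ 0 ∧ starRingEnd ℂ α = α ∧ E₁ * F₁ * E₁ = α • E₁ ∧ F₁ * E₁ * F₁ = α • F₁ := by
  classical
  have hPP := gradingEnd_mul_gradingEnd_of_deg e hdeg
  set P := gradingEnd e deg with hP
  have hE₁0 : E₁ ≠ 0 := fun h => one_ne_zero (hind 1 0 (by rw [h, smul_zero, zero_smul, add_zero])).1
  have hE₂0 : E₂ ≠ 0 := fun h => one_ne_zero (hind 0 1 (by rw [h, smul_zero, zero_smul, zero_add])).2
  have hF₁m : (1 - P) * F₁ * P = F₁ := (conjOp_grading H hn e hF hFc hF₁).1 hE₁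
  have hF₂m : (1 - P) * F₂ * P = F₂ := (conjOp_grading H hn e hF hFc hF₂).1 hE₂
  have hHR₁ := mul_conjOp_ne_zero_of_plus H ψ hn e hF hFc hdeg hE₁g hE₁ hE₁0 hF₁
  have hHR₂ := mul_conjOp_ne_zero_of_plus H ψ hn e hF hFc hdeg hE₂g hE₂ hE₂0 hF₂
  have hEFE0 := mul_conjOp_mul_ne_zero_of_plus H ψ hn e hF hFc hdeg hE₁g hE₁ hE₁0 hF₁
  have hEE : E₁ * E₁ = 0 := mul_eq_zero_of_plus_plus (K := ℂ) hPP hE₁ hE₁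
  have hFF : F₁ * F₁ = 0 := mul_eq_zero_of_minus_minus (K := ℂ) hPP hF₁m hF₁m
  -- `H₁ = [E₁, F₁]` commutes with `P`; `E₁F₁E₁ = ½(H₁E₁ − E₁H₁) ∈ 𝔤⁺`, `F₁E₁F₁ = ½(F₁H₁ − H₁F₁) ∈ 𝔤⁻`
  have hH₁g : E₁ * F₁ - F₁ * E₁ ∈ H.hodgeLieC := H.commutator_mem_hodgeLieC hE₁g hF₁g
  have hH₁P : P * (E₁ * F₁ - F₁ * E₁) = (E₁ * F₁ - F₁ * E₁) * P :=
    (mul_plus_minus_comm (K := ℂ) hPP hE₁ hF₁m).2.2.2.2.1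
  have hT : E₁ * F₁ * E₁ = (2 : ℂ)⁻¹ • ((E₁ * F₁ - F₁ * E₁) * E₁ - E₁ * (E₁ * F₁ - F₁ * E₁)) := by
    rw [sub_mul, mul_sub, mul_assoc F₁ E₁ E₁, hEE, mul_zero, sub_zero, ← mul_assoc E₁ E₁ F₁, hEE, zero_mul,
      zero_sub, sub_neg_eq_add, ← mul_assoc, ← two_smul ℂ (E₁ * F₁ * E₁), smul_smul, inv_mul_cancel₀ (two_ne_zero' ℂ),
      one_smul]
  have hTg : E₁ * F₁ * E₁ ∈ H.hodgeLieC := by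
    rw [hT]; exact H.hodgeLieC.smul_mem _ (H.commutator_mem_hodgeLieC hH₁g hE₁g)
  have hTm : P * (E₁ * F₁ * E₁) * (1 - P) = E₁ * F₁ * E₁ := by
    obtain ⟨h1, h2, -, -⟩ := zero_mul_plus (K := ℂ) hPP hH₁P hE₁ hF₁m
    rw [hT, mul_smul_comm, smul_mul_assoc, mul_sub P ((E₁ * F₁ - F₁ * E₁) * E₁) (E₁ * (E₁ * F₁ - F₁ * E₁)),
      sub_mul (P * ((E₁ * F₁ - F₁ * E₁) * E₁)) (P * (E₁ * (E₁ * F₁ - F₁ * E₁))) (1 - P), h1, h2]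
  obtain ⟨x, y, hxy⟩ := hspan _ hTg hTm
  -- kill with `F₂`: `y = 0`
  have hy : y = 0 := by
    have h := congrArg (fun T : Module.End ℂ (ℂ ⊗[ℚ] V) => T * F₂) hxy
    simp only [add_mul, smul_mul_assoc, mul_assoc, k12, mul_zero, smul_zero, zero_add] at h
    exact (smul_eq_zero.1 h.symm).resolve_right hHR₂.1
  rw [hy, zero_smul, add_zero] at hxy
  -- the same for `F₁E₁F₁` through conjugation of `𝔤⁻` into `𝔤⁺`
  have hT' : F₁ * E₁ * F₁ = (2 : ℂ)⁻¹ • (F₁ * (E₁ * F₁ - F₁ * E₁) - (E₁ * F₁ - F₁ * E₁) * F₁) := by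
    rw [sub_mul, mul_sub, ← mul_assoc F₁ F₁ E₁, hFF, zero_mul, sub_zero, mul_assoc E₁ F₁ F₁, hFF, mul_zero,
      zero_sub, sub_neg_eq_add, ← mul_assoc, ← two_smul ℂ (F₁ * E₁ * F₁), smul_smul, inv_mul_cancel₀ (two_ne_zero' ℂ),
      one_smul]
  have hT'g : F₁ * E₁ * F₁ ∈ H.hodgeLieC := by
    rw [hT']; exact H.hodgeLieC.smul_mem _ (H.commutator_mem_hodgeLieC hF₁g hH₁g)
  have hT'm : (1 - P) * (F₁ * E₁ * F₁) * P = F₁ * E₁ * F₁ := by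
    obtain ⟨-, -, h3, h4⟩ := zero_mul_plus (K := ℂ) hPP hH₁P hE₁ hF₁m
    rw [hT', mul_smul_comm, smul_mul_assoc, mul_sub (1 - P) (F₁ * (E₁ * F₁ - F₁ * E₁)) ((E₁ * F₁ - F₁ * E₁) * F₁),
      sub_mul ((1 - P) * (F₁ * (E₁ * F₁ - F₁ * E₁))) ((1 - P) * ((E₁ * F₁ - F₁ * E₁) * F₁)) P, h4, h3]
  -- write the conjugate of `F₁E₁F₁` in `𝔤⁺`
  obtain ⟨Tb, hTb⟩ := exists_conjOp (F₁ * E₁ * F₁)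
  have hTbg : Tb ∈ H.hodgeLieC := by
    rw [hodgeLieC_eq_spanC] at hT'g ⊢; exact conjOp_mem_spanC hT'g hTb
  have hTbm : P * Tb * (1 - P) = Tb := (conjOp_grading H hn e hF hFc hTb).2.1 hT'm
  obtain ⟨x', y', hxy'⟩ := hspan _ hTbg hTbm
  -- `F₁E₁F₁ = conj x' • F₁ + conj y' • F₂`
  have hF₁E₁F₁ : F₁ * E₁ * F₁ = starRingEnd ℂ x' • F₁ + starRingEnd ℂ y' • F₂ := by
    refine LinearMap.ext fun v => ?_
    have h : (F₁ * E₁ * F₁) v = conj (Tb (conj v)) := by rw [hTb, conj_conj, conj_conj]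
    rw [h, hxy', LinearMap.add_apply, LinearMap.smul_apply, LinearMap.smul_apply, map_add, conj_smul, conj_smul,
      ← hF₁, ← hF₂, LinearMap.add_apply, LinearMap.smul_apply, LinearMap.smul_apply]
  have hy' : starRingEnd ℂ y' = 0 := by
    have h := congrArg (fun T : Module.End ℂ (ℂ ⊗[ℚ] V) => T * E₂) hF₁E₁F₁
    simp only [add_mul, smul_mul_assoc, mul_assoc, k21', mul_zero, smul_zero, zero_add] at h
    exact (smul_eq_zero.1 h.symm).resolve_right hHR₂.2
  rw [hy', zero_smul, add_zero] at hF₁E₁F₁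
  -- the two constants agree
  have hxx : x = starRingEnd ℂ x' := by
    have h1 : F₁ * (E₁ * F₁ * E₁) = x • (F₁ * E₁) := by rw [hxy, mul_smul_comm]
    have h2 : F₁ * (E₁ * F₁ * E₁) = starRingEnd ℂ x' • (F₁ * E₁) := by
      rw [← mul_assoc F₁ (E₁ * F₁) E₁, ← mul_assoc F₁ E₁ F₁, hF₁E₁F₁, smul_mul_assoc]
    exact smul_left_injective ℂ hHR₁.2 (h1.symm.trans h2)
  have hx0 : x ≠ 0 := by
    intro h0; rw [h0, zero_smul] at hxy; exact hEFE0 hxy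
  -- `x` is real: conjugate `E₁F₁E₁ = x E₁`
  have hxre : starRingEnd ℂ x = x := by
    have h : F₁ * E₁ * F₁ = starRingEnd ℂ x • F₁ := by
      refine LinearMap.ext fun v => ?_
      have hE₁b : ∀ v, E₁ v = conj (F₁ (conj v)) := fun v => by rw [hF₁, conj_conj, conj_conj]
      have hA : ∀ v, (F₁ * E₁) v = conj ((E₁ * F₁) (conj v)) := fun v => (conjOp_mul_apply hF₁ hE₁b v).symm
      have h2 : (F₁ * E₁ * F₁) v = conj ((E₁ * F₁ * E₁) (conj v)) := (conjOp_mul_apply hA hF₁ v).symm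
      rw [h2, hxy, LinearMap.smul_apply, conj_smul, ← hF₁ v, LinearMap.smul_apply]
    have h' := h.symm.trans hF₁E₁F₁
    have hF₁0 : F₁ ≠ 0 := fun h0 => hHR₁.2 (by rw [h0, zero_mul])
    rw [← hxx] at h'
    exact smul_left_injective ℂ hF₁0 h'
  refine ⟨x, hx0, hxre, hxy, ?_⟩
  rw [hF₁E₁F₁, ← hxx]

end HodgeStructure

end Literature.AlgebraicGeometry.Motives

end
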